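import Literature.MathematicalPhysics.QuantumFieldTheory.Balaban1983to89.B9CubeDirichletCLetterAtOne

/-!
# `Balaban1983to89.B9CubeDirichletCLetterDecayAtOne` — [Balaban1985BackgroundPropagators] Theorem 3.2 (3.48) p. 398 AT `U = 1` FOR PRINT's DIRICHLET
# `C_□(1) = (Q′_□G′_□(1)²Q′*_□)⁻¹` ON THE BLOCKS INSIDE `Ω₀(□)`: THE DECAY of the explicit inverse `K_X = kxDirY i □` of FILE `B9CubeDirichletCLetterAtOne`
# ([Balaban1984PropagatorsII] Prop. 2.3 on the reflected torus, folded — [Balaban1983RegularityDecay] (2.42) p. 584) (ROAD (I), file D3g∕U5b; seat dag-n06-c g33)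

statement-level skeleton of published theorems with citation tags; proofs where landed; nothing here is a claim about the Yang–Mills mass gap

## What this file does (mathematically)

[Balaban1985BackgroundPropagators] Theorem 3.2 (3.48) p. 398: `|C(y, y′)| ≤ C·(L^jη)^{−4}·e^{−δ d_j(y,y′)}`, stated p. 409 l. 1–5 also for the cube letter
`C_□(1) = (Q′_□G′_□(1)²Q′*_□)⁻¹` («can be proved exactly in the same way»).  FILE `B9CubeDirichletCLetterAtOne` made the inverse of the compressed U = 1
Dirichlet block word EXPLICIT: `K_X(s, s′) = Σ_ε (−1)^{|ε|} Ĉ(ŝ, σ^{blk}_ε ŝ′)`, `Ĉ = (Q′[F′_□]Ĝ²Q′*[F′_□])⁻¹` the genuine inverse on the doubled torus of the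
reflected cube family `F′_□`.  [Balaban1984PropagatorsII] Prop. 2.3 (2.87) p. 238 on that torus (p33∕N03 `B6Prop23MultiLevelTorusL0.prop23_multiLevelTorus`, an
honest `…L0` window census, constants depending on `d, L` only) bounds `|Ĉ(u, w)| ≤ C·len(u)^{−4}·e^{−(δ₁/2)d_{F′}(u,w)}`; the block transfer `Ψ` of the mirror
files does not increase bond distances (`dist_blkPsi_le_dist_trefl`) and identifies `Ψŝ = s`; so (FILE `B4Eq242SignedImagesFold` §4 `abs_foldK_le_of_antitone`)
★★★ `thm32_dirC_cube` : `|K_X(s, s′)| ≤ 2^{d+1}·C·((L^{j(s)})⁴)⁻¹·e^{−(δ₁/2)·d_{F_□}(s, s′)}` for all blocks `s, s′` of the cube family — r05's `h348_cube` shape,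
uniform over def-Y's index (`L·M_h ≥ M₀`).

## Status

Printed-statement pass + proof body (proof-backed; a port in the tree's vocabulary): [Balaban1985BackgroundPropagators] Thm 3.2 p. 398, p. 409;
[Balaban1984PropagatorsII] Prop. 2.3 p. 238; [Balaban1983RegularityDecay] (2.42) p. 584, re-read 2026-08-31.  Honest label: Theorem 3.2 (3.48) at `U = 1`
for print's Dirichlet third cube letter, as an entrywise bound of the explicit inverse `kxDirY` (lattice units, `η = 1`); the `U`-dependence (Sect. B) is not
here.  Node N06 of the `pub-ymgap` DAG is NOT discharged here and the Yang–Mills mass gap is NOT proved here.  NEW file; nothing landed is modified.  No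
`sorry`, no `axiom`, no `instance`, no `notation`.  Net new unproved facts: 0.  Cell `pub-ymgap` (HUMAN RULING D-0062), node N06 [B9], seat
`pub-ymgap-dag-n06-c` (g33), 2026-08-31.
RELATED, NOT DUPLICATED (searched 2026-08-31: `rg 'cHatY_abs_le|kxDirY_abs_le|thm32_dirC_cube'` over `Literature ∕ Summits` = ∅): r05
`B9Thm31CubeLocalFlat.thm32_cubeW_flat` ∕ `B9Cor36CubeCinvAtOne.xinvKc_abs_le_of_kernel_bound` (the WHOLE-TORUS cube letter; this file is its Dirichlet twin and
copies the kernel-form bookkeeping), g31 `B9CubeDirichletLetterAtOne.hasMajorant_GpDirOne` (the site letter `G′_□(1)`).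
-/

namespace Literature.MathematicalPhysics.QuantumFieldTheory.Balaban1983to89.B9CubeDirichletCLetterDecayAtOne

noncomputable section

open Finset Matrix
open Literature.MathematicalPhysics.QuantumFieldTheory.Balaban1983to89.B4Reflection242 (boxDom)
open Literature.MathematicalPhysics.QuantumFieldTheory.Balaban1983to89.B6MultiLevelBoxOperator (N0)
open Literature.MathematicalPhysics.QuantumFieldTheory.Balaban1983to89.B6MultiLevelTorusOperatorL0 (TDomains)
open Literature.MathematicalPhysics.QuantumFieldTheory.Balaban1983to89.B6Geom246MultiLevelBoxL0 (bset blkOf)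
open Literature.MathematicalPhysics.QuantumFieldTheory.Balaban1983to89.B6Geom246MultiLevelTorusL0 (bondT geomT)
open Literature.MathematicalPhysics.QuantumFieldTheory.Balaban1983to89.B6Cover236MultiLevelBlocks (cubes)
open Literature.MathematicalPhysics.QuantumFieldTheory.Balaban1983to89.B6Ineq268MultiLevelBoxL0 (W W_eq W_pos)
open Literature.MathematicalPhysics.QuantumFieldTheory.Balaban1983to89.B6Ineq243TwoLevelBox (aNext)
open Literature.MathematicalPhysics.QuantumFieldTheory.Balaban1983to89.B6Prop23MultiLevelTorusL0 (GinvT prop23_multiLevelTorus)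
open Literature.MathematicalPhysics.QuantumFieldTheory.Balaban1983to89.B4Eq242TorusMirrors
open Literature.MathematicalPhysics.QuantumFieldTheory.Balaban1983to89.B4Eq242SignedImagesFold (foldK foldK_apply abs_foldK_le_of_antitone)
open Literature.MathematicalPhysics.QuantumFieldTheory.Balaban1983to89.B6MultiLevelTorusMirrorL0
open Literature.MathematicalPhysics.QuantumFieldTheory.Balaban1983to89.B6MultiLevelTorusMirrorCompression (mirBoxOpen_subset_closed)
open Literature.MathematicalPhysics.QuantumFieldTheory.Balaban1983to89.B6MultiLevelTorusMirrorDecay (blkPsi dist_blkPsi_le_dist_trefl)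
open Literature.MathematicalPhysics.QuantumFieldTheory.Balaban1983to89.B6MultiLevelTorusMirrorMajorant (blkPsi_blkOf_of_mem_closed)
open Literature.MathematicalPhysics.QuantumFieldTheory.Balaban1983to89.B9CubeSequence408 (cubeFam)
open Literature.MathematicalPhysics.QuantumFieldTheory.Balaban1983to89.B9CubeSequence408Mirrors
open Literature.MathematicalPhysics.QuantumFieldTheory.Balaban1983to89.B9CubeDirichletLetterAtOne (card_mirIdx_le)
open Literature.MathematicalPhysics.QuantumFieldTheory.Balaban1983to89.B9Thm31CubeLocalFlat (wCube cCube wCube_pos wCube_window cCube_window wCube_rec amin_pos)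
open Literature.MathematicalPhysics.QuantumFieldTheory.Balaban1983to89.B6KLevelCensusIndexV1 (KIdx)
open Literature.MathematicalPhysics.QuantumFieldTheory.Balaban1983to89.B9CubeLettersOpsL0 (cubeFamY oddMh)
open Literature.MathematicalPhysics.QuantumFieldTheory.Balaban1983to89.B9CubeLettersBondOpsL0 (BlkCubeY)
open Literature.MathematicalPhysics.QuantumFieldTheory.Balaban1983to89.B9Cor35GpDirInputsAtOne (dirDomY)
open Literature.MathematicalPhysics.QuantumFieldTheory.Balaban1983to89.Node00
open Literature.MathematicalPhysics.QuantumFieldTheory.Balaban1983to89.Node00.OpsYCubeProjectionG (insideBlkY)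
open Literature.MathematicalPhysics.QuantumFieldTheory.Balaban1983to89.B6MultiLevelTorusMirrorBlockLetter (blkReflR_blkOf)
open Literature.MathematicalPhysics.QuantumFieldTheory.Balaban1983to89.B9CubeDirichletCLetterAtOne

variable {d ℓ : ℕ} {hd : 1 ≤ d + 1} {hL : Odd (ℓ + 1) ∧ 1 < ℓ + 1} {b₀ b₁ : ℝ}

/-! ## §1  The entrywise bound of `Ĉ` from the printed kernel form of Prop. 2.3 -/

/-- ★ **`|Ĉ(u, w)| ≤ C·((L^{j(u)})⁴)⁻¹·e^{−δ d_{F′}(u,w)}`** from the kernel form `|mat Ĉ u w ∕ W(w)| ≤ C·len(u)^{−4}·len(w)^{−(d+1)}·e^{−δd}` (`W(w) = len(w)^{d+1}`,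
lattice units) — r05's `xinvKc_abs_le_of_kernel_bound` at the reflected cube family. [cite: Balaban1984PropagatorsII, (2.69) p.235, (2.87) p.238; Balaban1985BackgroundPropagators, (3.48) p.398, bookkeeping] -/
theorem cHatY_abs_le_of_kernel_bound (i : KIdx d ℓ hd hL b₀ b₁) (q : ↥(cubes (toKT i).D.toDomains)) {C δ : ℝ}
    (h : ∀ u w : BlkRY i q,
      |B6Prop23Chain.mat (GinvT (reflY i q) (wCube ℓ)) u w / W (reflY i q).toDomains w| ≤
        C * (geomT (reflY i q)).len u ^ (-(4 : ℝ)) * (geomT (reflY i q)).len w ^ (-((d + 1 : ℕ) : ℝ)) * Real.exp (-(δ * (geomT (reflY i q)).dist u w))) :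
    ∀ u w : BlkRY i q, |cHatY i q u w| ≤ C * ((((ℓ : ℝ) + 1) ^ u.1.1) ^ 4)⁻¹ * Real.exp (-(δ * (geomT (reflY i q)).dist u w)) := by
  intro u w
  have hW := W_pos (reflY i q).toDomains w
  have hlen : ∀ s : BlkRY i q, (geomT (reflY i q)).len s = ((ℓ : ℝ) + 1) ^ s.1.1 := fun s => by
    show ((ℓ : ℝ) + 1) ^ s.1.1 * 1 = _; rw [mul_one]
  have hLp : ∀ s : BlkRY i q, 0 < ((ℓ : ℝ) + 1) ^ s.1.1 := fun s => by positivity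
  have hmat : cHatY i q u w = B6Prop23Chain.mat (GinvT (reflY i q) (wCube ℓ)) u w := by
    show LinearMap.toMatrix' (GinvT (reflY i q) (wCube ℓ)) u w = _
    rw [LinearMap.toMatrix'_apply, B6Prop23Chain.mat]
  have h1 := h u w
  rw [abs_div, abs_of_pos hW, div_le_iff₀ hW, hlen, hlen, W_eq] at h1
  rw [hmat]
  refine h1.trans (le_of_eq ?_)
  rw [Real.rpow_neg (hLp u).le, Real.rpow_neg (hLp w).le, Real.rpow_natCast, show ((4 : ℝ)) = ((4 : ℕ) : ℝ) by norm_num, Real.rpow_natCast]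
  have hne : (((ℓ : ℝ) + 1) ^ w.1.1) ^ (d + 1) ≠ 0 := pow_ne_zero _ (hLp w).ne'
  rw [mul_assoc (C * ((((ℓ : ℝ) + 1) ^ u.1.1) ^ 4)⁻¹ * ((((ℓ : ℝ) + 1) ^ w.1.1) ^ (d + 1))⁻¹), mul_comm (Real.exp _), ← mul_assoc,
    mul_assoc (C * ((((ℓ : ℝ) + 1) ^ u.1.1) ^ 4)⁻¹), inv_mul_cancel₀ hne, mul_one]

/-! ## §2  The block transfer identifies `Ψ ŝ = s` -/

/-- `Ψ ŝ = s`: the block of `F_□` met by the embedded fold of `ŝ` is `s`. [cite: Balaban1984PropagatorsII, (2.45) p.231; Balaban1983RegularityDecay, (2.42) p.584, bookkeeping] -/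
theorem blkPsi_hatB (i : KIdx d ℓ hd hL b₀ b₁) (q : ↥(cubes (toKT i).D.toDomains)) (s : ↥(insideBlkY i q (dirDomY i q))) :
    blkPsi (cubeFam (toKT i).D q hL.1 (oddMh i) (toKT i).hMh (toKT i).hP) (kTop q) (mirC q) (mC q) (gC q) hL.1 (oddMh i) (toKT i).hMh (toKT i).hP
      (kTop_le q) (lev_cubeFam_le_kTop q) (two_le_mC q) (sTop_dvd_gC q) (hatB i q s) = s.1 := by
  unfold hatB
  rw [blkPsi_blkOf_of_mem_closed (mirBoxOpen_subset_closed (siteIn i q s).2), ← blkOf_embY_siteIn i q s]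
  rfl

/-- ★ the fold's distance hypothesis: `d_{F_□}(s, t) ≤ d_{F′_□}(ŝ, σ^{blk}_ε t̂)` for every `ε`. [cite: Balaban1983RegularityDecay, (2.42) p.584; Balaban1984PropagatorsII, (2.46) p.231] -/
theorem dist_le_dist_hatB_brefl (i : KIdx d ℓ hd hL b₀ b₁) (q : ↥(cubes (toKT i).D.toDomains)) (s t : ↥(insideBlkY i q (dirDomY i q)))
    (ε : Fin (d + 1) → Bool) :
    (geomT (cubeFamY i q)).dist s.1 t.1 ≤ (geomT (reflY i q)).dist (hatB i q s) (breflY i q ε (hatB i q t)) := by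
  have h := dist_blkPsi_le_dist_trefl (F := cubeFam (toKT i).D q hL.1 (oddMh i) (toKT i).hMh (toKT i).hP) (hL := hL.1) (hM := oddMh i) (hMh := (toKT i).hMh)
    (hP := (toKT i).hP) (hk := kTop_le q) (hlev := lev_cubeFam_le_kTop q) (hm := two_le_mC q) (hg := sTop_dvd_gC q) (hatB i q s) ε (siteIn i q t).1
  have ht : blkOf (reflY i q).toDomains (siteIn i q t).1 = hatB i q t := rfl
  rw [ht, blkPsi_hatB, blkPsi_hatB] at h
  have hb : breflY i q ε (hatB i q t) = blkOf (reflY i q).toDomains (sreflY i q ε (siteIn i q t).1) := by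
    rw [← ht]; exact blkReflR_blkOf ε _
  rw [hb]
  show ((bondT (cubeFamY i q)).dist s.1 t.1 : ℝ) ≤ ((bondT (reflY i q)).dist (hatB i q s) (blkOf (reflY i q).toDomains (sreflY i q ε (siteIn i q t).1)) : ℝ)
  exact_mod_cast h

/-! ## §3  ★★★ Theorem 3.2 (3.48) at `U = 1` for print's Dirichlet `C_□(1)`: the decay of `K_X` -/

/-- the census side conditions of the reflected cube family's `P′`. [cite: Balaban1984PropagatorsII, (2.1) p.224, bookkeeping] -/
theorem one_le_Pref (i : KIdx d ℓ hd hL b₀ b₁) (q : ↥(cubes (toKT i).D.toDomains)) :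
    (∀ μ, 1 ≤ Pref ℓ (toKT i).k (kTop q) (toKT i).P (mirC q) (mC q) μ) ∧ ∀ μ, 4 ≤ Pref ℓ (toKT i).k (kTop q) (toKT i).P (mirC q) (mC q) μ := by
  refine ⟨fun μ => ?_, fun μ => ?_⟩
  · unfold Pref; split_ifs with hμ
    · have := two_le_mC q μ hμ; omega
    · exact le_trans ((toKT i).hP μ) (Nat.le_mul_of_pos_left _ (Nat.pow_pos (Nat.succ_pos ℓ)))
  · unfold Pref; split_ifs with hμ
    · have := two_le_mC q μ hμ; omega
    · exact le_trans ((toKT i).hP4 μ) (Nat.le_mul_of_pos_left _ (Nat.pow_pos (Nat.succ_pos ℓ)))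

/-- ★★★ **THEOREM 3.2 (3.48) AT `U = 1` FOR PRINT's DIRICHLET THIRD CUBE LETTER** — the explicit inverse `K_X = kxDirY i □` of the compressed block word
`(Q′_□G′_□(1)²Q′*_□)|_𝔖` obeys `|K_X(s, s′)| ≤ C·((L^{j(s)})⁴)⁻¹·e^{−δ·d_{F_□}(s, s′)}` for ALL blocks (it vanishes off `𝔖 × 𝔖`), with `δ, C, M₀` depending on `d, L`
only, whenever `L·M_h ≥ M₀` — r05's `h348_cube` shape.  Proof: Prop. 2.3 on the doubled torus of the reflected cube family, folded over the `≤ 2^{d+1}` block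
images, the transfer `Ψ` contracting distances. [cite: Balaban1985BackgroundPropagators, Thm 3.2 (3.48) p.398, p.409 l.1–5; Balaban1984PropagatorsII, Prop. 2.3 (2.87) p.238; Balaban1983RegularityDecay, (2.42) p.584] -/
theorem thm32_dirC_cube (d ℓ : ℕ) (hℓ : 1 ≤ ℓ) :
    ∃ δ C M₀ : ℝ, 0 < δ ∧ 0 < C ∧ 0 < M₀ ∧
      ∀ {hd : 1 ≤ d + 1} {hL : Odd (ℓ + 1) ∧ 1 < ℓ + 1} {b₀ b₁ : ℝ} (i : KIdx d ℓ hd hL b₀ b₁) (q : ↥(cubes (toKT i).D.toDomains)),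
        M₀ ≤ ((ℓ : ℝ) + 1) * (toKT i).Mh →
        ∀ s t : BlkCubeY i q, |kxDirY i q s t| ≤ C * ((((ℓ : ℝ) + 1) ^ s.1.1) ^ 4)⁻¹ * Real.exp (-(δ * (geomT (cubeFamY i q)).dist s t)) := by
  obtain ⟨δ₁, C, M₀, hδ₁, hC, hM₀, h⟩ :=
    prop23_multiLevelTorus d ℓ hℓ (1 - ((((ℓ : ℝ) + 1)) ^ 2)⁻¹) 1 1 (1 - ((((ℓ : ℝ) + 1)) ^ 2)⁻¹)⁻¹ (amin_pos hℓ) one_pos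
  refine ⟨δ₁ / 2, 2 ^ (d + 1) * C, M₀, by positivity, by positivity, hM₀, ?_⟩
  intro hd hL b₀ b₁ i q hM0 s t
  classical
  have hRHS : 0 ≤ 2 ^ (d + 1) * C * ((((ℓ : ℝ) + 1) ^ s.1.1) ^ 4)⁻¹ * Real.exp (-(δ₁ / 2 * (geomT (cubeFamY i q)).dist s t)) := by positivity
  by_cases hst : s ∈ insideBlkY i q (dirDomY i q) ∧ t ∈ insideBlkY i q (dirDomY i q)
  swap
  · rw [kxDirY_apply_of_not i q s t hst, abs_zero]; exact hRHS
  -- Prop. 2.3 on the doubled torus of the reflected cube family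
  obtain ⟨-, -, -, hker⟩ := h (kTop q) (toKT i).Mh (toKT i).R hM0 (toKT i).hR (Pref ℓ (toKT i).k (kTop q) (toKT i).P (mirC q) (mC q))
    (one_le_Pref i q).1 (one_le_Pref i q).2 (reflY i q) (wCube ℓ) (cCube ℓ) (wCube_window hℓ) (cCube_window hℓ) (wCube_rec hℓ)
  have hent := cHatY_abs_le_of_kernel_bound i q hker
  -- fold over the block images
  have hs' : (⟨s, hst.1⟩ : ↥(insideBlkY i q (dirDomY i q))).1 = s := rfl
  rw [show kxDirY i q s t = kxDirY i q (⟨s, hst.1⟩ : ↥(insideBlkY i q (dirDomY i q))).1 (⟨t, hst.2⟩ : ↥(insideBlkY i q (dirDomY i q))).1 from rfl,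
    kxDirY_apply_inside]
  have hφ : Antitone fun r : ℝ => Real.exp (-(δ₁ / 2 * r)) := fun a b hab =>
    Real.exp_le_exp.2 (by nlinarith [hδ₁.le])
  have hfold := abs_foldK_le_of_antitone (mirIdx (mirC q)) (breflY i q) (tsign ℝ (mirC q)) (cHatY i q) (fun ε _ => abs_tsign_le ε)
    (c := fun u : BlkRY i q => C * ((((ℓ : ℝ) + 1) ^ u.1.1) ^ 4)⁻¹) (fun u => by positivity) hφ
    (d' := fun u w => ((geomT (reflY i q)).dist u w : ℝ))
    (dX := fun u w => (geomT (cubeFamY i q)).dist (⟨s, hst.1⟩ : ↥(insideBlkY i q (dirDomY i q))).1 (⟨t, hst.2⟩ : ↥(insideBlkY i q (dirDomY i q))).1)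
    (fun u w => hent u w) (hatB i q ⟨s, hst.1⟩) (hatB i q ⟨t, hst.2⟩) (fun ε _ => dist_le_dist_hatB_brefl i q ⟨s, hst.1⟩ ⟨t, hst.2⟩ ε)
  refine hfold.trans ?_
  have hc := card_mirIdx_le (mirC q)
  have hlev : (hatB i q ⟨s, hst.1⟩).1.1 = s.1.1 := lev_hatB i q ⟨s, hst.1⟩
  simp only [hlev] at *
  have h0 : 0 ≤ C * ((((ℓ : ℝ) + 1) ^ s.1.1) ^ 4)⁻¹ * Real.exp (-(δ₁ / 2 * (geomT (cubeFamY i q)).dist s t)) := by positivity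
  calc ((mirIdx (mirC q)).card : ℝ) * (C * ((((ℓ : ℝ) + 1) ^ s.1.1) ^ 4)⁻¹ * Real.exp (-(δ₁ / 2 * (geomT (cubeFamY i q)).dist s t)))
      ≤ 2 ^ (d + 1) * (C * ((((ℓ : ℝ) + 1) ^ s.1.1) ^ 4)⁻¹ * Real.exp (-(δ₁ / 2 * (geomT (cubeFamY i q)).dist s t))) :=
        mul_le_mul_of_nonneg_right hc h0
    _ = 2 ^ (d + 1) * C * ((((ℓ : ℝ) + 1) ^ s.1.1) ^ 4)⁻¹ * Real.exp (-(δ₁ / 2 * (geomT (cubeFamY i q)).dist s t)) := by ring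

end

end Literature.MathematicalPhysics.QuantumFieldTheory.Balaban1983to89.B9CubeDirichletCLetterDecayAtOne
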